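import Mathlib
import HarnessLib
import Summits.HubbardSuperconductivity.HubbardSuperconductivity.Theorems.KLProgrammeKLRegimeVolumeLimitDysonHartreeCurrent
import Summits.HubbardSuperconductivity.HubbardSuperconductivity.Theorems.KLProgrammeKLRegimeVolumeLimitDensityParseval

/-!
# The `U`-linear (Hartree) term of the bare-frame VL carrier is `U` times the space–time AVERAGE of the local density insertion
# (seat hubbard-kl-k3c5-p2, g2)

Route `KLProgramme`, gen-4 child 5 `KLRegimeVolumeLimitV12` (stmt-HubbardSuperconductivity-19858), `stub_vl_bound`, Step 2 of
HOME/hubbard-kl-k3c5-p2/TAU-BRIDGE.md §6.  `…DysonHartreeCurrent` writes `Σ̂⁰_{L,M}(k,σ) = (βL²/Z)(U(βL²)⁻³∫e^{−V}Σ_qψ̂⁺_{qσ̄}ψ̂⁻_{qσ̄} + U²·…)`;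
`…DensityParseval` is the finite-cutoff Parseval identity for the local pair.  Since `e^{−V}` is even (central), the two combine to

  `U(βL²)⁻³·∫dμ_C e^{−V}Σ_q ψ̂⁺_{qσ}ψ̂⁻_{qσ} = U(βL²)⁻²·Σ_x∫_{[0,β]} ∫dμ_C ψ⁺_{(x,t)σ}ψ⁻_{(x,t)σ}e^{−V} dt`

(`hartree_term_eq_spacetime_average`), i.e. after the prefactor `βL²/Z`: the `U`-linear term of `Σ̂⁰(k,σ̄)` equals
`U·(βL²)⁻¹Σ_x∫₀^β ⟨ψ⁺_{(x,t)σ}ψ⁻_{(x,t)σ}⟩_{L,M} dt` — `U` times the space–time average of the normalised local insertion, each of whose values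
tends (t2, `…ThermalGreenMatsubaraTimeAllU` / `…MatsubaraAllU`) to the equal-time thermal two-point function at coinciding points as `M → ∞`.
Everything is proved; no definition.
-/

noncomputable section

namespace Summit.HubbardSuperconductivity.HubbardSuperconductivity.Theorems.TwoPointAssembly

set_option linter.dupNamespace false -- summit = problem name (single-conjunct summit), D-0017

open Finset MeasureTheory Literature.MathematicalPhysics.QuantumLattice Literature.Probability.LatticeModels GrassmannAlgebra

variable {L M : ℕ} [NeZero L]

/-- **HARTREE TERM = U × SPACE–TIME AVERAGE OF THE LOCAL DENSITY INSERTION** (finite cutoff, `β > 0`, every real `U`, any spin `σ`):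
`U(βL²)⁻³·∫dμ_C e^{−V}·Σ_qψ̂⁺_{qσ}ψ̂⁻_{qσ} = U(βL²)⁻²·Σ_x∫_{[0,β]}∫dμ_C ψ⁺_{(x,t)σ}ψ⁻_{(x,t)σ}e^{−V} dt` (bare covariance `C`, `V = V(U)`). -/
theorem hartree_term_eq_spacetime_average {β : ℝ} (hβ : 0 < β) (U μ : ℝ) (σ : Fin 2) :
    (U : ℂ) * (((1 / (β * (L : ℝ) ^ 2) ^ 3 : ℝ) : ℂ)) *
        gaussExpect ℂ (hubbardCovarianceCT L M β μ 0 0)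
          (grassmannExp (-(hubbardInteraction L M β U)) * ∑ q : FreqMomentum L M, psiPlus q σ * psiMinus q σ) =
      (U : ℂ) * (((1 / (β * (L : ℝ) ^ 2) ^ 2 : ℝ) : ℂ)) *
        ∑ x : TorusSite 2 L, ∫ t in Set.Icc (0 : ℝ) β,
          gaussExpect ℂ (hubbardCovarianceCT L M β μ 0 0)
            (positionField L M β 0 σ x t * positionField L M β 1 σ x t * grassmannExp (-(hubbardInteraction L M β U))) := by
  have hβL : ((β * (L : ℝ) ^ 2 : ℝ) : ℂ) ≠ 0 := by
    have hL : (L : ℝ) ≠ 0 := by exact_mod_cast NeZero.ne L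
    exact_mod_cast mul_ne_zero hβ.ne' (pow_ne_zero 2 hL)
  set E : HubbardGrassmann L M := grassmannExp (-(hubbardInteraction L M β U)) with hE
  -- `e^{−V}` is even, hence central
  have hEeven : E ∈ evenOdd ℂ 0 := by
    rw [hE, ← hubbardInteractionCT_zero_frame]
    exact grassmannExp_mem_evenOdd_zero ℂ (neg_mem (hubbardInteractionCT_mem_evenOdd_zero (L := L) (M := M) β U 0))
      (isNilpotent_hubbardInteractionCT (L := L) (M := M) β U 0).neg
  have hcomm : E * ∑ q : FreqMomentum L M, psiPlus q σ * psiMinus q σ = ∑ q : FreqMomentum L M, psiPlus q σ * psiMinus q σ * E := by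
    rw [(commute_of_mem_evenOdd_zero ℂ hEeven _).eq, Finset.sum_mul]
  rw [hcomm, map_sum, sum_integral_gaussExpect_positionField_pair_mul hβ]
  push_cast
  field_simp
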